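import Literature.RepresentationTheory.HeisenbergGroup.WeylSystemVacuumSubspace
import Mathlib.RepresentationTheory.Basic
import HarnessLib

/-!
# A Weyl system with a commuting group action: irreducibility lives on the vacuum subspace (von Neumann 1931, §5)

Topic `RepresentationTheory/HeisenbergGroup`; namespace `Literature.RepresentationTheory.HeisenbergGroup`.

Let `W` be a Weyl system over `(V, J)` on a Hilbert space `E` (`IsWeylSystem`), with Gaussian projection `P` and
vacuum subspace `M₀` (`WeylSystemVacuumProjection`, `WeylSystemVacuumSubspace`), and let a group `G` act on `E` by
isometries `τ g` COMMUTING with every `W(x)` (the situation of two commuting Heisenberg groups sharing their centre —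
two places of a number field — once one of them is put in Weyl form).  Then `τ` preserves `M₀`
(`WeylSystemVacuumSubspace` §4), and this file proves that NOTHING IS LOST in passing to `M₀`:

* §1 `vacuumVec_mem_of_invariant` — `P` maps every closed `W`-invariant subspace into itself;
  `vacuumVec_apply_mem_of_le_vacuumSubspace` — for `k ∈ K ≤ M₀`, `P (W(x) k) = γ(x) k ∈ K`;
* §2 **`vacuum_trivial_of_irreducible`** — if the closed subspaces of `E` invariant under all `W(x)` and all `τ g`
  are `⊥, ⊤`, then the closed `τ`-invariant subspaces of `M₀` are `⊥, M₀`;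
* §3 **`irreducible_of_vacuum_trivial`** — conversely, if the closed `τ`-invariant subspaces of `M₀` are `⊥, M₀`,
  then the closed `(W, τ)`-invariant subspaces of `E` are `⊥, ⊤` (totality of the translates of `M₀` and
  `eq_zero_of_forall_vacuumVec_apply_eq_zero`).

With `WeylSystemVacuumExtension` (an isometry of vacuum subspaces extends to an intertwiner) this reduces the
uniqueness of an irreducible representation of `H(W₁ ⊕ W₂)` to the uniqueness for `H(W₂)` acting on the `W₁`-vacuum
subspace — the gluing of places in the adelic uniqueness of `ρ_ψ` [GelbartRogawski1991, §3.1 p. 454 L20–21].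
Everything is PROVED (Mathlib + tree); no cited statement is used as a hypothesis.

## References

* [vonNeumann1931] J. von Neumann, Die Eindeutigkeit der Schrödingerschen Operatoren, Math. Ann. 104 (1931)
  570–578, §5.
* [Folland1989] G. B. Folland, *Harmonic Analysis in Phase Space*, Princeton University Press, 1989, §1.5
  Theorem (1.50) (doi:10.1515/9781400882427).
-/

noncomputable section

open MeasureTheory Complex Filter
open scoped InnerProductSpace FourierTransform ComplexConjugate Topology

namespace Literature.RepresentationTheory.HeisenbergGroup

variable {V : Type*} [NormedAddCommGroup V] [InnerProductSpace ℝ V] [FiniteDimensional ℝ V]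
  [MeasurableSpace V] [BorelSpace V]
variable {E : Type*} [NormedAddCommGroup E] [InnerProductSpace ℂ E] [CompleteSpace E]

namespace IsWeylSystem

variable {J : V →ₗ[ℝ] V} {W : V → E →L[ℂ] E}

/-! ## 1. `P` and invariant subspaces -/

/-- **`P` preserves every closed `W`-invariant subspace** (`P k = ∫ γ(z) W(z) k dz` is orthogonal to `Kᗮ`).
[cite: vonNeumann1931, §5] -/
theorem vacuumVec_mem_of_invariant (hW : IsWeylSystem J W) {K : Submodule ℂ E} (hKc : IsClosed (K : Set E))
    (hK : ∀ (x : V), ∀ v ∈ K, W x v ∈ K) {k : E} (hk : k ∈ K) : vacuumVec W k ∈ K := by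
  haveI : CompleteSpace K := hKc.completeSpace_coe
  rw [← Submodule.orthogonal_orthogonal K, Submodule.mem_orthogonal]
  intro w hw
  rw [hW.inner_vacuumVec_right]
  have h0 : ∀ z : V, (gauss z : ℂ) * ⟪w, W z k⟫_ℂ = 0 := fun z => by
    rw [Submodule.mem_orthogonal'] at hw
    rw [hw _ (hK z k hk), mul_zero]
  simp_rw [h0, integral_zero]

/-- For `k` in a subspace `K` of the vacuum subspace, `P (W(x) k) = γ(x) k ∈ K`. [cite: vonNeumann1931, §5] -/
theorem vacuumVec_apply_of_mem_vacuumSubspace (hW : IsWeylSystem J W) {k : E} (hk : k ∈ hW.vacuumSubspace)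
    (x : V) : vacuumVec W (W x k) = (gauss x : ℂ) • k := by
  rw [hW.mem_vacuumSubspace] at hk
  conv_lhs => rw [← hk]
  rw [hW.vacuumVec_weyl_vacuumVec, hk]

omit [FiniteDimensional ℝ V] [MeasurableSpace V] [BorelSpace V] [CompleteSpace E] in
/-- `W(y)` maps the span of the translates `W(x) k`, `k ∈ K`, into itself. [cite: vonNeumann1931, §5] -/
theorem apply_mem_span_translates (hW : IsWeylSystem J W) (K : Submodule ℂ E) (y : V) {v : E}
    (hv : v ∈ Submodule.span ℂ {w : E | ∃ (x : V) (k : E), k ∈ K ∧ w = W x k}) :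
    W y v ∈ Submodule.span ℂ {w : E | ∃ (x : V) (k : E), k ∈ K ∧ w = W x k} := by
  induction hv using Submodule.span_induction with
  | mem w hw =>
    obtain ⟨x, k, hk, rfl⟩ := hw
    rw [hW.mul]
    exact Submodule.smul_mem _ _ (Submodule.subset_span ⟨y + x, k, hk, rfl⟩)
  | zero => rw [map_zero]; exact Submodule.zero_mem _
  | add u u' _ _ hu hu' => rw [map_add]; exact Submodule.add_mem _ hu hu'
  | smul c u _ hu => rw [map_smul]; exact Submodule.smul_mem _ _ hu

/-! ## 2. From `E` to the vacuum subspace -/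

section Action

variable {G : Type*} [Group G] (τ : Representation ℂ G E)

omit [CompleteSpace E] in
/-- an isometric `τ g` is continuous. [cite: vonNeumann1931, §5] -/
theorem continuous_rep_of_norm_eq (hτu : ∀ (g : G) (v : E), ‖τ g v‖ = ‖v‖) (g : G) : Continuous (τ g) :=
  AddMonoidHomClass.continuous_of_bound (τ g) 1 fun v => by rw [hτu, one_mul]

omit [CompleteSpace E] in
/-- `τ g` as a bounded operator. [cite: vonNeumann1931, §5] -/
theorem exists_clm_eq (hτu : ∀ (g : G) (v : E), ‖τ g v‖ = ‖v‖) (g : G) :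
    ∃ T : E →L[ℂ] E, ∀ v, T v = τ g v :=
  ⟨⟨τ g, continuous_rep_of_norm_eq τ hτu g⟩, fun _ => rfl⟩

/-- A commuting isometric action preserves the vacuum subspace. [cite: vonNeumann1931, §5] -/
theorem rep_mem_vacuumSubspace (hW : IsWeylSystem J W) (hτu : ∀ (g : G) (v : E), ‖τ g v‖ = ‖v‖)
    (hτW : ∀ (g : G) (x : V) (v : E), τ g (W x v) = W x (τ g v)) (g : G) {m : E}
    (hm : m ∈ hW.vacuumSubspace) : τ g m ∈ hW.vacuumSubspace := by
  obtain ⟨T, hT⟩ := exists_clm_eq τ hτu g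
  have h := hW.mem_vacuumSubspace_of_commute T (fun x v => by rw [hT, hT, hτW]) hm
  rwa [hT] at h

/-- **Irreducibility descends to the vacuum subspace**: if the closed subspaces of `E` invariant under every `W(x)`
and every `τ g` are `⊥` and `⊤`, then every closed `τ`-invariant subspace of `M₀` is `⊥` or `M₀`.
[cite: vonNeumann1931, §5] -/
theorem vacuum_trivial_of_irreducible (hW : IsWeylSystem J W) (hτu : ∀ (g : G) (v : E), ‖τ g v‖ = ‖v‖)
    (hτW : ∀ (g : G) (x : V) (v : E), τ g (W x v) = W x (τ g v))
    (hirr : ∀ K : Submodule ℂ E, IsClosed (K : Set E) → (∀ (x : V), ∀ v ∈ K, W x v ∈ K) →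
      (∀ (g : G), ∀ v ∈ K, τ g v ∈ K) → K = ⊥ ∨ K = ⊤)
    (K : Submodule ℂ E) (hKc : IsClosed (K : Set E)) (hKM : K ≤ hW.vacuumSubspace)
    (hKτ : ∀ (g : G), ∀ v ∈ K, τ g v ∈ K) : K = ⊥ ∨ K = hW.vacuumSubspace := by
  -- the closed span `K'` of the translates of `K` is `(W, τ)`-invariant
  set S : Submodule ℂ E := Submodule.span ℂ {w : E | ∃ (x : V) (k : E), k ∈ K ∧ w = W x k} with hS
  set K' : Submodule ℂ E := S.topologicalClosure with hK'
  have hK'W : ∀ (x : V), ∀ v ∈ K', W x v ∈ K' := by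
    intro x v hv
    rw [hK', ← SetLike.mem_coe, Submodule.topologicalClosure_coe] at hv ⊢
    exact closure_mono (Set.image_subset_iff.2 fun u hu => hW.apply_mem_span_translates K x hu)
      (image_closure_subset_closure_image (W x).continuous ⟨v, hv, rfl⟩)
  have hSτ : ∀ (g : G), ∀ v ∈ S, τ g v ∈ S := by
    intro g v hv
    induction hv using Submodule.span_induction with
    | mem w hw =>
      obtain ⟨x, k, hk, rfl⟩ := hw
      rw [hτW]
      exact Submodule.subset_span ⟨x, τ g k, hKτ g k hk, rfl⟩
    | zero => rw [map_zero]; exact Submodule.zero_mem _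
    | add u u' _ _ hu hu' => rw [map_add]; exact Submodule.add_mem _ hu hu'
    | smul c u _ hu => rw [map_smul]; exact Submodule.smul_mem _ _ hu
  have hK'τ : ∀ (g : G), ∀ v ∈ K', τ g v ∈ K' := by
    intro g v hv
    rw [hK', ← SetLike.mem_coe, Submodule.topologicalClosure_coe] at hv ⊢
    exact closure_mono (Set.image_subset_iff.2 fun u hu => hSτ g u hu)
      (image_closure_subset_closure_image (continuous_rep_of_norm_eq τ hτu g) ⟨v, hv, rfl⟩)
  have hKS : K ≤ S := fun k hk => Submodule.subset_span ⟨0, k, hk, by rw [hW.apply_zero]⟩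
  -- `P` maps `K'` into `K`
  have hPS : ∀ v ∈ S, vacuumVec W v ∈ K := by
    intro v hv
    induction hv using Submodule.span_induction with
    | mem w hw =>
      obtain ⟨x, k, hk, rfl⟩ := hw
      rw [hW.vacuumVec_apply_of_mem_vacuumSubspace (hKM hk)]
      exact Submodule.smul_mem _ _ hk
    | zero => rw [← zero_smul ℂ (0 : E), vacuumVec_smul, zero_smul]; exact Submodule.zero_mem _
    | add u u' _ _ hu hu' => rw [hW.vacuumVec_add]; exact Submodule.add_mem _ hu hu'
    | smul c u _ hu => rw [vacuumVec_smul]; exact Submodule.smul_mem _ _ hu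
  have hPK' : ∀ v ∈ K', vacuumVec W v ∈ K := by
    intro v hv
    rw [hK', ← SetLike.mem_coe, Submodule.topologicalClosure_coe] at hv
    have hcont : Continuous (vacuumVec W : E → E) := by
      have hC : 0 ≤ ∫ z : V, gauss z := integral_nonneg fun z => (gauss_pos z).le
      refine (LipschitzWith.of_dist_le_mul (K := Real.toNNReal ((∫ z : V, gauss z) + 1)) fun u v => ?_).continuous
      rw [dist_eq_norm, dist_eq_norm, ← hW.vacuumVec_sub, Real.coe_toNNReal _ (by linarith)]
      refine (hW.norm_vacuumVec_le _).trans ?_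
      nlinarith [norm_nonneg (u - v)]
    have h1 : vacuumVec W v ∈ closure ((vacuumVec W) '' (S : Set E)) :=
      image_closure_subset_closure_image hcont ⟨v, hv, rfl⟩
    have h2 : (vacuumVec W) '' (S : Set E) ⊆ K := by
      rintro _ ⟨u, hu, rfl⟩
      exact hPS u hu
    exact hKc.closure_subset_iff.2 h2 h1
  rcases hirr K' S.isClosed_topologicalClosure hK'W hK'τ with h | h
  · left
    rw [eq_bot_iff]
    intro k hk
    have : k ∈ K' := S.le_topologicalClosure (hKS hk)
    rw [h] at this
    exact this
  · right
    refine le_antisymm hKM fun m hm => ?_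
    have hPm : vacuumVec W m = m := (hW.mem_vacuumSubspace).mp hm
    rw [← hPm]
    exact hPK' m (by rw [h]; exact Submodule.mem_top)

/-! ## 3. From the vacuum subspace to `E` -/

/-- **Irreducibility lifts from the vacuum subspace**: if the closed `τ`-invariant subspaces of `M₀` are `⊥` and `M₀`,
then the closed subspaces of `E` invariant under all `W(x)` and all `τ g` are `⊥` and `⊤`.
[cite: vonNeumann1931, §5] -/
theorem irreducible_of_vacuum_trivial (hW : IsWeylSystem J W) (hτu : ∀ (g : G) (v : E), ‖τ g v‖ = ‖v‖)
    (hτW : ∀ (g : G) (x : V) (v : E), τ g (W x v) = W x (τ g v))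
    (hvac : ∀ K : Submodule ℂ E, IsClosed (K : Set E) → K ≤ hW.vacuumSubspace →
      (∀ (g : G), ∀ v ∈ K, τ g v ∈ K) → K = ⊥ ∨ K = hW.vacuumSubspace)
    (K : Submodule ℂ E) (hKc : IsClosed (K : Set E)) (hKW : ∀ (x : V), ∀ v ∈ K, W x v ∈ K)
    (hKτ : ∀ (g : G), ∀ v ∈ K, τ g v ∈ K) : K = ⊥ ∨ K = ⊤ := by
  set L : Submodule ℂ E := K ⊓ hW.vacuumSubspace with hL
  have hLc : IsClosed (L : Set E) := by
    rw [hL, Submodule.coe_inf]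
    exact hKc.inter hW.isClosed_vacuumSubspace
  have hLτ : ∀ (g : G), ∀ v ∈ L, τ g v ∈ L := fun g v hv =>
    ⟨hKτ g v hv.1, hW.rep_mem_vacuumSubspace τ hτu hτW g hv.2⟩
  rcases hvac L hLc inf_le_right hLτ with h | h
  · -- `P (W a k) ∈ K ∩ M₀ = ⊥` for `k ∈ K`, so `k = 0`
    left
    rw [eq_bot_iff]
    intro k hk
    have hk0 : k = 0 := hW.eq_zero_of_forall_vacuumVec_apply_eq_zero fun a => by
      have hmem : vacuumVec W (W a k) ∈ L :=
        ⟨hW.vacuumVec_mem_of_invariant hKc hKW (hKW a k hk), hW.vacuumVec_mem_vacuumSubspace _⟩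
      rw [h] at hmem
      exact (Submodule.mem_bot ℂ).1 hmem
    rw [hk0]
    exact Submodule.zero_mem _
  · -- `M₀ ⊆ K`, and the translates of `M₀` are total
    right
    have hMK : hW.vacuumSubspace ≤ K := fun m hm => by
      have : m ∈ L := by rw [h]; exact hm
      exact this.1
    haveI : CompleteSpace K := hKc.completeSpace_coe
    rw [← Submodule.orthogonal_eq_bot_iff, eq_bot_iff]
    intro u hu
    rw [Submodule.mem_bot]
    refine hW.eq_zero_of_forall_inner_apply_eq_zero fun x m hm => ?_
    rw [Submodule.mem_orthogonal'] at hu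
    exact hu _ (hKW x m (hMK hm))

end Action

end IsWeylSystem

end Literature.RepresentationTheory.HeisenbergGroup

end
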